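import Mathlib

/-!
# The Erdős threshold `⌈2 log₂ n⌉` is eventually below `⌈n^{1/2-ε}⌉`

Stub `stub_thresholdBelowPoly` of the line `Sketch` for the crux `RamseyNotNP` (stmt-PneNP-9814):
for `0 < ε < 1/2` there is `N` with `Nat.clog 2 (n²) ≤ ⌈n^{1/2-ε}⌉₊` for all `n ≥ N`.

Why: it transfers the standard-shape planted-clique refutation hypothesis (about
`⌈n^{1/2-ε}⌉`-clique-freeness) down to the Erdős threshold `k(n) = ⌈2 log₂ n⌉ = Nat.clog 2 (n²)`
via `SimpleGraph.CliqueFree.mono`, once `k(n) ≤ ⌈n^{1/2-ε}⌉₊`.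

Proof (folklore): with `δ := 1/2 - ε > 0`, `Real.log = o(x^δ)` at `+∞`
(`isLittleO_log_rpow_atTop`), so eventually `log n ≤ (log 2 / 2) · n^δ`, i.e.
`log (n²) ≤ ⌈n^δ⌉₊ · log 2`, i.e. `n² ≤ 2^{⌈n^δ⌉₊}` (`Real.le_pow_of_log_le`), which is
`Nat.clog 2 (n²) ≤ ⌈n^δ⌉₊` (`Nat.clog_le_of_le_pow`).
-/

set_option linter.dupNamespace false

namespace Summit.PneNP.PneNP.Theorems.RamseyNotNP.TypicalCapture

/-- Eventual domination `log n ≤ (log 2 / 2) · n^δ` along the naturals, for `δ > 0`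
(from `isLittleO_log_rpow_atTop`). [folklore] -/
theorem thresholdBelowPoly_log_le_eventually {δ : ℝ} (hδ : 0 < δ) :
    ∃ N : ℕ, ∀ n ≥ N, Real.log (n : ℝ) ≤ Real.log 2 / 2 * (n : ℝ) ^ δ := by
  have hlo := (isLittleO_log_rpow_atTop hδ).bound (half_pos (Real.log_pos one_lt_two))
  obtain ⟨N, hN⟩ := Filter.eventually_atTop.1 ((tendsto_natCast_atTop_atTop (R := ℝ)).eventually hlo)
  refine ⟨N, fun n hn => ?_⟩
  have h := hN n hn
  rw [Real.norm_eq_abs, Real.norm_eq_abs, abs_of_nonneg (Real.rpow_nonneg n.cast_nonneg δ)] at h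
  exact (le_abs_self _).trans h

/-- **Stub C — the Erdős threshold is below every polynomial.** For `0 < ε < 1/2`, eventually
`Nat.clog 2 (n²) ≤ ⌈n^{1/2-ε}⌉₊`. [folklore] -/
theorem stub_thresholdBelowPoly :
    ∀ ε : ℝ, 0 < ε → ε < 1 / 2 → ∃ N : ℕ, ∀ n ≥ N,
      Nat.clog 2 (n ^ 2) ≤ ⌈(n : ℝ) ^ (1 / 2 - ε)⌉₊ := by
  intro ε _ hε
  have hδ : 0 < 1 / 2 - ε := sub_pos.2 hε
  obtain ⟨N, hN⟩ := thresholdBelowPoly_log_le_eventually hδ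
  refine ⟨N, fun n hn => Nat.clog_le_of_le_pow ?_⟩
  have hlog := hN n hn
  have hceil : (n : ℝ) ^ (1 / 2 - ε) ≤ (⌈(n : ℝ) ^ (1 / 2 - ε)⌉₊ : ℝ) := Nat.le_ceil _
  have hlog2 : 0 < Real.log 2 := Real.log_pos one_lt_two
  have key : ((n : ℝ)) ^ 2 ≤ (2 : ℝ) ^ ⌈(n : ℝ) ^ (1 / 2 - ε)⌉₊ := by
    refine Real.le_pow_of_log_le two_pos ?_
    rw [Real.log_pow, Nat.cast_ofNat]
    calc 2 * Real.log n ≤ Real.log 2 * (n : ℝ) ^ (1 / 2 - ε) := by linarith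
      _ ≤ Real.log 2 * ⌈(n : ℝ) ^ (1 / 2 - ε)⌉₊ := by gcongr
      _ = ⌈(n : ℝ) ^ (1 / 2 - ε)⌉₊ * Real.log 2 := mul_comm _ _
  exact_mod_cast key

end Summit.PneNP.PneNP.Theorems.RamseyNotNP.TypicalCapture
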